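import Mathlib
import Summits.KontsevichZagierPeriods.Zeta5Search.PalindromicWBound
import Summits.KontsevichZagierPeriods.Zeta5Search.PalindromicUBound
import Summits.KontsevichZagierPeriods.Zeta5Search.GHatMomentsProof
import HarnessLib

/-!
# ζ(5) search — census g13's PALINDROMIC CLASS BOUNDS `PalindromicClassBoundW/U` are THEOREMS by name (the corner `wLBpal, uLBpal ≥ 2` is empty)

Cell `pub-zeta5` (HONEST FRAMING: systematic search; no irrationality claim unless certified), typer seat generation 10.
Typer g9 proved `min(wLBpal,1) ≤ v_p(W)` and `min(uLBpal,1) ≤ v_p(U)` (`PalindromicWBound`, `PalindromicUBound`), i.e. census g13's conjectures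
`PalindromicClassBoundW/U` (`Zeta5Search/PalindromicClassBounds.lean`) wherever the palindromic row bound is `≤ 1`.  The DEGREE COUNT
`Σ_{x<p} E_x = −(2d+5)` (`sum_classExp_val`, typer g10) closes the remaining corner: if `c·p < 2d+5` some class has `E_x ≤ −(c+1)`
(`exists_classExp_le_of_mul_lt`); with `c = 2` (the `W`-list is critical only for `p ≤ d+1`) resp. `c = 4` (`U`: `4p ≤ 2d+3`) that class is a
single-pole class (row `1`) or a multipole class of row `3 + E_x + bonus ≤ 1` resp. `5 + E_x + bonus ≤ 1`, so `wLBpal ≤ 1` and `uLBpal ≤ 1`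
ALWAYS (`wLBpal_le_one`, `uLBpal_le_one`).  Hence `palindromicClassBoundW_holds`, `palindromicClassBoundU_holds`.
`p`-adic valuations of rational numbers; nothing here bears on irrationality.
-/

noncomputable section

open Finset

namespace Summit.KontsevichZagierPeriods.Zeta5Search.ClusterValuation

open Summit.KontsevichZagierPeriods.Zeta5Search.DualSeries (InBox)
open Summit.KontsevichZagierPeriods.Zeta5Search.WedgeDictionary (coeffU coeffW dOf)
open Summit.KontsevichZagierPeriods.Zeta5Search.CasoratianValuation (InPolytope)

variable {p : ℕ} [hp : Fact p.Prime]

/-- **Pigeonhole on the degree count**: if `c·p < 2d + 5` then some class has exponent `≤ −(c+1)` (since `Σ_{x<p} E_x = −(2d+5)`). -/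
theorem exists_classExp_le_of_mul_lt (b : ℕ → ℤ) (hb : InPolytope b) (hp5 : 5 ≤ p) (c : ℕ)
    (h : (c : ℤ) * p < 2 * dOf b + 5) : ∃ x, x < p ∧ classExp b p x ≤ -(c : ℤ) - 1 := by
  by_contra hne
  push Not at hne
  have hsum := sum_classExp_val b hp5 hb.1.1 (fun j hj => ⟨(hb.1.2 j hj).1, hb.2.1 j hj⟩)
  have hge : ∑ _w : ZMod p, (-(c : ℤ)) ≤ ∑ w : ZMod p, classExp b p w.val :=
    sum_le_sum fun w _ => by have := hne w.val (ZMod.val_lt w); omega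
  rw [sum_const, card_univ, ZMod.card, nsmul_eq_mul, hsum] at hge
  nlinarith

omit hp in
/-- A pole-free class has `E_x ≥ 0`. -/
theorem classExp_nonneg_of_noPole (b : ℕ → ℤ) {x : ℕ} (h0 : classPoleCount b p x = 0) :
    0 ≤ classExp b p x := by
  have hnn : 0 ≤ ∑ s ∈ classSet b p x, netExp b s := sum_nonneg fun s hs => netExp_nonneg_of_noPole b h0 hs
  unfold classExp
  split_ifs <;> omega

omit hp in
/-- A single-pole class bounds `wLBpal` by `1`. -/
theorem wLBpal_le_one_of_single (b : ℕ → ℤ) {x : ℕ} (hx : x < p) (h1 : classPoleCount b p x = 1) : wLBpal b p ≤ 1 := by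
  unfold wLBpal
  refine getD_min_le (List.mem_append.2 (Or.inl ?_))
  unfold classRowListPal
  exact List.mem_filterMap.2 ⟨x, List.mem_range.2 hx, by rw [if_pos h1]⟩

omit hp in
/-- A single-pole class bounds `uLBpal` by `1`. -/
theorem uLBpal_le_one_of_single (b : ℕ → ℤ) {x : ℕ} (hx : x < p) (h1 : classPoleCount b p x = 1) : uLBpal b p ≤ 1 := by
  unfold uLBpal
  refine getD_min_le (List.mem_append.2 (Or.inl ?_))
  unfold classRowListPal
  exact List.mem_filterMap.2 ⟨x, List.mem_range.2 hx, by rw [if_pos h1]⟩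

omit hp in
/-- The multipole row `classBound b p x s` is at most `s + E_x + 1`. -/
theorem classBound_le (b : ℕ → ℤ) {x : ℕ} (s : ℕ) (hmulti : 2 ≤ classPoleCount b p x) :
    classBound b p x s ≤ (s : ℤ) + classExp b p x + 1 := by
  unfold classBound
  rw [if_pos hmulti]
  split_ifs <;> omega

/-- **`wLBpal ≤ 1` always** (in the polytope, `p ≥ 5` prime). -/
theorem wLBpal_le_one (b : ℕ → ℤ) (hb : InPolytope b) (hp5 : 5 ≤ p) : wLBpal b p ≤ 1 := by
  by_cases hpd : dOf b + 1 < (p : ℤ)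
  · exact (wLBpal_le_zero_of_lt b hpd).trans zero_le_one
  · obtain ⟨x, hx, hE⟩ := exists_classExp_le_of_mul_lt b hb hp5 2 (by push_cast; omega)
    rcases Nat.lt_trichotomy (classPoleCount b p x) 1 with h0 | h1 | h2
    · have := classExp_nonneg_of_noPole b (by omega : classPoleCount b p x = 0); omega
    · exact wLBpal_le_one_of_single b hx h1
    · exact (wLBpal_le_classBound b hx (by omega)).trans (by have := classBound_le b 3 (by omega : 2 ≤ classPoleCount b p x); omega)

/-- **`uLBpal ≤ 1` always** (in the polytope, `p ≥ 5` prime). -/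
theorem uLBpal_le_one (b : ℕ → ℤ) (hb : InPolytope b) (hp5 : 5 ≤ p) : uLBpal b p ≤ 1 := by
  by_cases hpd : 2 * dOf b + 3 < 4 * (p : ℤ)
  · exact (uLBpal_le_zero_of_lt b hpd).trans zero_le_one
  · obtain ⟨x, hx, hE⟩ := exists_classExp_le_of_mul_lt b hb hp5 4 (by push_cast; omega)
    rcases Nat.lt_trichotomy (classPoleCount b p x) 1 with h0 | h1 | h2
    · have := classExp_nonneg_of_noPole b (by omega : classPoleCount b p x = 0); omega
    · exact uLBpal_le_one_of_single b hx h1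
    · exact (uLBpal_le_classBound b hx (by omega)).trans (by have := classBound_le b 5 (by omega : 2 ≤ classPoleCount b p x); omega)

/-- **`PalindromicClassBoundW` is a theorem** (census g13): `wLBpal(b,p) ≤ v_p(W(b))` in the window. -/
theorem palindromicClassBoundW_holds : PalindromicClassBoundW := by
  intro b p hb hprime hp5 hwin hW
  haveI : Fact p.Prime := ⟨hprime⟩
  exact wLBpal_le_padicValRat_coeffW_of_le_one b hb hp5 hwin hW (wLBpal_le_one b hb hp5)

/-- **`PalindromicClassBoundU` is a theorem** (census g13): `uLBpal(b,p) ≤ v_p(U(b))` in the window. -/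
theorem palindromicClassBoundU_holds : PalindromicClassBoundU := by
  intro b p hb hprime hp5 hwin hU
  haveI : Fact p.Prime := ⟨hprime⟩
  have h := min_uLBpal_one_le_padicValRat_coeffU b hb hp5 hwin hU
  rwa [min_eq_left (uLBpal_le_one b hb hp5)] at h

end Summit.KontsevichZagierPeriods.Zeta5Search.ClusterValuation

end
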